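import Summits.QuantumFields.YangMills.Theorems.BalabanUVNodesN15CovariantLandauSopRowCT
import HarnessLib

/-!
# Route «BalabanUVNodes», node N15 = NE2, road (c) — PROGRAMME (P-S), XIII: THE FOURTH FLAT ROW `(Q′G′²Q′ᵀ)⁻¹(1)` WITH CONSTANTS UNIFORM IN THE MASS PARAMETER `a′ ∈ [a₁, a₂]`
# (monotone majorants of the T⁴ cell's Combes–Thomas constants `Jfree`, `γ′`, `K₂`, `EQG`, `deltaK` in `a′`) — the edition the King masses `a_K(1, L, K) ∈ [1 − L⁻², 1]` of
# n15-c∕221 require (dag-n15-c g23, n15-c∕222b)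

Cell `pub-ymgap`, seat `pub-ymgap-dag-n15-c` (generation g23; R134 (a), s1; HUMAN RULING D-0062; chair R424 venue).  `bears_on: R4∕N15 · K3⁸ SpineGivenEndpointR13SepCoPHV
(stmt-QuantumFields-27366)`; filed `--supports stmt-QuantumFields-27366 --as helper` — COUNT-NEUTRAL.  Three bookkeeping `def`s (`gwU`, `EQGu`, `deltaKu`: the worst-case constants over
`a′ ∈ [a₁, a₂]`) + theorems; 0 `sorry`; HYPOTHESIS-FREE.  Imports BY NAME n15-c∕222 (`norm_Kone_inv_apply_le`, `nsq_single_one`, …), the T⁴ cell's `CTScalarGreen.Jfree`,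
`CTScalarGreenComm.EQG`, `CTGaugeTerm.deltaK`, `CTWeightedEnergy.K1∕K2`, `CTAdmissibleRate` (continuity combinators).  Nothing in the tree is modified.

WHY.  n15-c∕222 `flatSopRow_ct` proves the row of `S(1)⁻¹` at ONE `a′`; n15-c∕221's displayed `S`-rows sit at King's masses `a′ = a_K(1, L, K)` which vary with the index in
`[1 − L⁻², 1]`.  The Combes–Thomas constants are MONOTONE in `a′` through `γ′(a′)` (increasing), `Jfree(a′, κ)` (increasing), `σ₀(a′)` (decreasing): so ONE rate `κ` and ONE constant serve a
whole interval `[a₁, a₂]`.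
* §1 monotonicity: `Jfree_mono_a`, `gammaPs_mono`, `sigma0_anti`, `K1_mono`, `K2_mono`, `EQG_le_EQGu`, `deltaK_le_deltaKu`; continuity `continuousAt_deltaKu`, `deltaKu_zero`.
* §2 ★★★ **`flatSopRow_ct_uniform`** — `∀ 0 < a₁ ≤ a₂ ∃ C_S δ > 0 ∀ a′ ∈ [a₁, a₂] ∀ M n k ι`: `HasMaj BC BC (mulVecLin (cSop M n 1 (a′n^{d+1}))⁻¹) (C_S·n^{d+1}·e^{−δ|y−y′|_T})`.

HONEST FRAMING ∕ LIMITS.  Real-analysis bookkeeping over n15-c∕222 (finite-dimensional Combes–Thomas of the T⁴ cell; constants OURS); NOT [Balaban1984PropagatorsII] Prop. 2.3 as printed;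
NE2⁺ NOT PRINTED; N15 of record untouched (DISCHARGED AS CONSUMED, p687738); counts UNMOVED (typed 28∕28 · discharged 8∕27); one finite 𝕋⁴ at fixed ε per index — NOT infinite volume ∕
OS ∕ mass gap ∕ Clay.  Restate-immune (no Theses import).
-/

noncomputable section

open scoped BigOperators Matrix Kronecker ComplexConjugate
open Filter Topology

namespace Summit.QuantumFields.YangMills.BalabanUVNodes.N15.CovLandau

open Literature.MathematicalPhysics.QuantumFieldTheory.Balaban1983to89
open Literature.MathematicalPhysics.QuantumFieldTheory.Balaban1983to89.B5Prop11Plancherel (Tor fine)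
open Literature.MathematicalPhysics.QuantumFieldTheory.Balaban1983to89.B5RealFields (IsReal reM reM_apply)
open Literature.MathematicalPhysics.QuantumFieldTheory.Balaban1983to89.B11SectG (BlockNorm HasMaj)
open Literature.MathematicalPhysics.QuantumFieldTheory.Balaban1983to89.B6UnitTorusCarrier (unitTorusGeo)
open Literature.MathematicalPhysics.QuantumFieldTheory.Balaban1983to89.T4EtaRateCoeffDefect (fibre)
open Literature.MathematicalPhysics.QuantumFieldTheory.King1986.Torus (tdistT)
open Summit.QuantumFields.BalabanUV.T4Continuum.ScalarAveragedPropagator (gammaPs gammaPs_pos)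
open Summit.QuantumFields.BalabanUV.T4Continuum.ScalarAveragedCompression (sigma0 sigma0_pos)
open Summit.QuantumFields.BalabanUV.T4Continuum.ScalarGaugeProjectionUnit (Kone isUnit_det_Kone)
open Summit.QuantumFields.BalabanUV.T4Continuum.CTWeightedEnergy (K1 K2 K1_nonneg K2_nonneg)
open Summit.QuantumFields.BalabanUV.T4Continuum.CTScalarGreen (Jfree Jfree_nonneg Jfree_zero c1 c1_nonneg)
open Summit.QuantumFields.BalabanUV.T4Continuum.CTScalarGreenComm (gw epsQ EQG)
open Summit.QuantumFields.BalabanUV.T4Continuum.CTGaugeTerm (epsQ_nonneg)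
open Summit.QuantumFields.BalabanUV.T4Continuum.CTAdmissibleRate (continuousAt_K2_comp continuous_c1 continuous_epsQ continuous_Jfree exists_pos_le_one_of_eventually)
open Summit.QuantumFields.YangMills.BalabanUVNodes.N15.MatrixSpecies (liftBlk)
open Summit.QuantumFields.YangMills.BalabanUVNodes.N15.BlockRows (hasMaj_mulVecLin_of_sum_abs_le)

variable {d : ℕ}

/-! ## §1 Monotone majorants of the Combes–Thomas constants in `a′` -/

section Mono

/-- `Jfree` is increasing in `a′`. [folklore] -/
theorem Jfree_mono_a (D : ℕ) {a' a₂ : ℝ} (h : a' ≤ a₂) (κ Λ : ℝ) : Jfree D a' κ Λ ≤ Jfree D a₂ κ Λ := by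
  unfold Jfree
  have : 0 ≤ Real.cosh (κ * Λ) - 1 := by linarith [Real.one_le_cosh (κ * Λ)]
  nlinarith

/-- `γ′` is increasing in `a′ > 0`. [folklore] -/
theorem gammaPs_mono (D : ℕ) {a₁ a' : ℝ} (ha₁ : 0 < a₁) (h : a₁ ≤ a') : gammaPs D a₁ ≤ gammaPs D a' := by
  unfold gammaPs
  have ha' : 0 < a' := lt_of_lt_of_le ha₁ h
  have hm : max (2 / a') (8 * (D : ℝ)) ≤ max (2 / a₁) (8 * (D : ℝ)) := max_le_max (div_le_div_of_nonneg_left (by norm_num) ha₁ h) le_rfl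
  have h0 : 0 < 1 + max (2 / a') (8 * (D : ℝ)) := by
    have h8 : (0 : ℝ) ≤ 8 * (D : ℝ) := by positivity
    linarith [le_max_right (2 / a') (8 * (D : ℝ))]
  exact inv_anti₀ h0 (by linarith)

/-- `σ₀` is decreasing in `a′`. [folklore] -/
theorem sigma0_anti (D : ℕ) {a' a₂ : ℝ} (ha' : 0 < a') (h : a' ≤ a₂) : sigma0 D a₂ ≤ sigma0 D a' := by
  unfold sigma0
  have h36 := pow_pos (show (0 : ℝ) < 36 by norm_num) D
  have hD : (0 : ℝ) ≤ 4 * (D : ℝ) := by positivity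
  have h0 : 0 < (36 : ℝ) ^ D * (4 * D + a') := mul_pos h36 (by linarith)
  exact inv_anti₀ h0 (by nlinarith)

/-- `K₁(γ, J, c)` is decreasing in `γ > 0` and increasing in `J ≥ 0`. [folklore] -/
theorem K1_mono {γ₁ γ J J₂ : ℝ} (c : ℝ) (hγ₁ : 0 < γ₁) (hγ : γ₁ ≤ γ) (hJ0 : 0 ≤ J) (hJ : J ≤ J₂) : K1 γ J c ≤ K1 γ₁ J₂ c := by
  unfold K1
  refine Real.sqrt_le_sqrt ?_
  have hγ0 : 0 < γ := lt_of_lt_of_le hγ₁ hγ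
  have hJ2 : 0 ≤ J₂ := hJ0.trans hJ
  have h2 : (γ ^ 2)⁻¹ ≤ (γ₁ ^ 2)⁻¹ := inv_anti₀ (by positivity) (pow_le_pow_left₀ hγ₁.le hγ 2)
  have e1 : (1 + 2 * J) * c ^ 2 / γ ^ 2 ≤ (1 + 2 * J₂) * c ^ 2 / γ₁ ^ 2 := by
    rw [div_eq_mul_inv, div_eq_mul_inv]
    exact mul_le_mul (by nlinarith [sq_nonneg c]) h2 (by positivity) (by positivity)
  have e2 : 2 * (1 + 2 * J) ^ 2 / γ ^ 2 ≤ 2 * (1 + 2 * J₂) ^ 2 / γ₁ ^ 2 := by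
    rw [div_eq_mul_inv, div_eq_mul_inv]
    exact mul_le_mul (by nlinarith) h2 (by positivity) (by positivity)
  linarith

/-- `K₂(γ, J, c)` is decreasing in `γ > 0` and increasing in `J ≥ 0`. [folklore] -/
theorem K2_mono {γ₁ γ J J₂ : ℝ} (c : ℝ) (hγ₁ : 0 < γ₁) (hγ : γ₁ ≤ γ) (hJ0 : 0 ≤ J) (hJ : J ≤ J₂) : K2 γ J c ≤ K2 γ₁ J₂ c := by
  unfold K2
  refine Real.sqrt_le_sqrt ?_
  have hγ0 : 0 < γ := lt_of_lt_of_le hγ₁ hγ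
  have h1 := K1_mono c hγ₁ hγ hJ0 hJ
  have h2 : (γ ^ 2)⁻¹ ≤ (γ₁ ^ 2)⁻¹ := inv_anti₀ (by positivity) (pow_le_pow_left₀ hγ₁.le hγ 2)
  have hK0 := K1_nonneg γ₁ J₂ c
  have e1 : 2 * K1 γ J c / γ ≤ 2 * K1 γ₁ J₂ c / γ₁ :=
    div_le_div₀ (by positivity) (by linarith) hγ₁ hγ
  have e2 : c ^ 2 / γ ^ 2 ≤ c ^ 2 / γ₁ ^ 2 := by rw [div_eq_mul_inv, div_eq_mul_inv]; exact mul_le_mul_of_nonneg_left h2 (sq_nonneg c)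
  linarith

variable (D : ℕ) (a₁ a₂ : ℝ)

/-- the worst-case weighted gap `γ′(a₁) − Jfree(a₂, κ)`. [folklore] -/
def gwU (κ : ℝ) : ℝ := gammaPs D a₁ - Jfree D a₂ κ 1

/-- the worst-case `EQG` over `a′ ∈ [a₁, a₂]` (same shape, `γ′ ↦ γ′(a₁)`, `γw ↦ gwU`, `Jfree ↦ Jfree(a₂)`, `a′ ↦ a₂`). [folklore] -/
def EQGu (κ : ℝ) : ℝ :=
  epsQ κ 1 * (gwU D a₁ a₂ κ)⁻¹
    + (gwU D a₁ a₂ κ)⁻¹ * c1 D κ * (Real.sqrt ((gammaPs D a₁)⁻¹) + c1 D κ * (gammaPs D a₁)⁻¹)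
    + (K2 (gwU D a₁ a₂ κ) (Jfree D a₂ κ 1) (c1 D κ) + c1 D κ * (gwU D a₁ a₂ κ)⁻¹) * (c1 D κ * (gammaPs D a₁)⁻¹)
    + a₂ * (gwU D a₁ a₂ κ)⁻¹ * (epsQ κ 1 * (gammaPs D a₁)⁻¹)

/-- the worst-case `deltaK` over `a′ ∈ [a₁, a₂]`. [folklore] -/
def deltaKu (κ : ℝ) : ℝ := EQGu D a₁ a₂ κ * ((gammaPs D a₁)⁻¹ + EQGu D a₁ a₂ κ) + (gammaPs D a₁)⁻¹ * EQGu D a₁ a₂ κ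

variable {D a₁ a₂}

/-- `EQG(a′) ≤ EQGu` on `[a₁, a₂]` when the worst-case gap is positive. [folklore] -/
theorem EQG_le_EQGu (ha₁ : 0 < a₁) {a' : ℝ} (h1 : a₁ ≤ a') (h2 : a' ≤ a₂) {κ : ℝ} (hgap : 0 < gwU D a₁ a₂ κ) : EQG D a' κ 1 ≤ EQGu D a₁ a₂ κ := by
  have ha' : 0 < a' := lt_of_lt_of_le ha₁ h1
  have hγ₁ := (gammaPs_pos (d := D) (a' := a₁)).1
  have hγm := gammaPs_mono D ha₁ h1
  have hJm := Jfree_mono_a D h2 κ 1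
  have hJ0 := Jfree_nonneg D ha'.le κ 1
  have hgw : gwU D a₁ a₂ κ ≤ gw D a' κ 1 := by unfold gwU gw; linarith
  have hgw0 : 0 < gw D a' κ 1 := lt_of_lt_of_le hgap hgw
  have hi1 : (gw D a' κ 1)⁻¹ ≤ (gwU D a₁ a₂ κ)⁻¹ := inv_anti₀ hgap hgw
  have hi2 : (gammaPs D a')⁻¹ ≤ (gammaPs D a₁)⁻¹ := inv_anti₀ hγ₁ hγm
  have hi3 : Real.sqrt ((gammaPs D a')⁻¹) ≤ Real.sqrt ((gammaPs D a₁)⁻¹) := Real.sqrt_le_sqrt hi2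
  have hc := c1_nonneg D κ
  have hε := epsQ_nonneg zero_le_one κ
  have hK := K2_mono (c1 D κ) hgap hgw hJ0 hJm
  have hK0 := K2_nonneg (gwU D a₁ a₂ κ) (Jfree D a₂ κ 1) (c1 D κ)
  have hiU : 0 ≤ (gwU D a₁ a₂ κ)⁻¹ := inv_nonneg.mpr hgap.le
  have hγU : 0 ≤ (gammaPs D a₁)⁻¹ := inv_nonneg.mpr hγ₁.le
  have hγa := (gammaPs_pos (d := D) (a' := a')).1
  have hγa' : 0 ≤ (gammaPs D a')⁻¹ := inv_nonneg.mpr hγa.le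
  have hx : 0 ≤ Real.sqrt ((gammaPs D a')⁻¹) + c1 D κ * (gammaPs D a')⁻¹ := by positivity
  have ha₂0 : 0 ≤ a₂ := by linarith
  unfold EQG EQGu
  gcongr

/-- `deltaK(a′) ≤ deltaKu` on `[a₁, a₂]`. [folklore] -/
theorem deltaK_le_deltaKu (ha₁ : 0 < a₁) {a' : ℝ} (h1 : a₁ ≤ a') (h2 : a' ≤ a₂) {κ : ℝ} (hgap : 0 < gwU D a₁ a₂ κ) : BalabanUV.T4Continuum.CTGaugeTerm.deltaK D a' κ 1 ≤ deltaKu D a₁ a₂ κ := by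
  have hE := EQG_le_EQGu ha₁ h1 h2 hgap
  have hγ₁ := (gammaPs_pos (d := D) (a' := a₁)).1
  have hi2 : (gammaPs D a')⁻¹ ≤ (gammaPs D a₁)⁻¹ := inv_anti₀ hγ₁ (gammaPs_mono D ha₁ h1)
  have hE0 : 0 ≤ EQG D a' κ 1 := by
    have ha' : 0 < a' := lt_of_lt_of_le ha₁ h1
    have hgw0 : 0 < gw D a' κ 1 := lt_of_lt_of_le hgap (by unfold gwU gw; linarith [gammaPs_mono D ha₁ h1, Jfree_mono_a D h2 κ 1])
    have := c1_nonneg D κ; have := epsQ_nonneg zero_le_one κ; have := K2_nonneg (gw D a' κ 1) (Jfree D a' κ 1) (c1 D κ)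
    have := (gammaPs_pos (d := D) (a' := a')).1
    unfold EQG; positivity
  have hγ0 : 0 ≤ (gammaPs D a')⁻¹ := inv_nonneg.mpr (gammaPs_pos (d := D) (a' := a')).1.le
  have hγU : 0 ≤ (gammaPs D a₁)⁻¹ := inv_nonneg.mpr hγ₁.le
  have hEu : 0 ≤ EQGu D a₁ a₂ κ := hE0.trans hE
  unfold BalabanUV.T4Continuum.CTGaugeTerm.deltaK deltaKu
  gcongr

/-- `κ ↦ deltaKu(κ)` is continuous at `0` and vanishes there. [folklore] -/
theorem continuousAt_deltaKu : ContinuousAt (deltaKu D a₁ a₂) 0 ∧ deltaKu D a₁ a₂ 0 = 0 := by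
  have hγ₁ := (gammaPs_pos (d := D) (a' := a₁)).1
  have h1 : ContinuousAt (gwU D a₁ a₂) 0 := by unfold gwU; exact (continuous_const.sub (continuous_Jfree D a₂ 1)).continuousAt
  have h2 := (continuous_Jfree D a₂ 1).continuousAt (x := (0 : ℝ))
  have h3 := (continuous_c1 D).continuousAt (x := (0 : ℝ))
  have h4 := (continuous_epsQ 1).continuousAt (x := (0 : ℝ))
  have h0 : gwU D a₁ a₂ 0 ≠ 0 := by unfold gwU; rw [Jfree_zero, sub_zero]; exact hγ₁.ne'
  have h6 : ContinuousAt (fun κ : ℝ => K2 (gwU D a₁ a₂ κ) (Jfree D a₂ κ 1) (c1 D κ)) 0 := continuousAt_K2_comp h1 h2 h3 h0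
  have hE : ContinuousAt (EQGu D a₁ a₂) 0 := by
    unfold EQGu
    fun_prop (disch := assumption)
  refine ⟨by unfold deltaKu; fun_prop, ?_⟩
  have hc0 : c1 D 0 = 0 := by simp [c1]
  have he0 : epsQ 0 1 = 0 := by simp [epsQ]
  simp [deltaKu, EQGu, hc0, he0]

end Mono

/-! ## §2 The fourth flat row with constants uniform in `a′ ∈ [a₁, a₂]` -/

section Row

variable (L : ℕ)

/-- ★★★ **THE FOURTH FLAT ROW, UNIFORMLY IN THE MASS PARAMETER**: for `0 < a₁ ≤ a₂` there are `C_S, δ > 0` with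
`HasMaj BC BC (mulVecLin (cSop M n 1 (a′n^{d+1}))⁻¹) (C_S·n^{d+1}·e^{−δ|y−y′|_T})` for every `a′ ∈ [a₁, a₂]`, every torus `M`, `n ≥ 1`, `k`, `ι`.
[cite: Balaban1984PropagatorsII, Prop. 2.3 p.231 (shape); Balaban1984PropagatorsI, Lemma 2.2 p.41 (Combes–Thomas method)] -/
theorem flatSopRow_ct_uniform {a₁ a₂ : ℝ} (ha₁ : 0 < a₁) (h12 : a₁ ≤ a₂) :
    ∃ CS δ : ℝ, 0 < CS ∧ 0 < δ ∧ ∀ (a' : ℝ), a₁ ≤ a' → a' ≤ a₂ → ∀ (M : Fin (d + 1) → ℕ) [∀ μ, NeZero (M μ)] (n : ℕ) [NeZero n] (k : ℕ) (ι : Type) [Fintype ι] [DecidableEq ι],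
      HasMaj (BlockNorm.ofBlocks (unitTorusGeo L k M) (liftBlk (fun y : Tor M => y) ι)) (BlockNorm.ofBlocks (unitTorusGeo L k M) (liftBlk (fun y : Tor M => y) ι))
        (Matrix.mulVecLin (cSop M n (fun (_ : Fin (d + 1)) (_ : Tor (fine n M)) => (1 : Matrix ι ι ℝ)) (a' * (n : ℝ) ^ (d + 1)))⁻¹)
        (fun y y' => CS * (n : ℝ) ^ (d + 1) * Real.exp (-(δ * tdistT M y y'))) := by
  classical
  have ha₂ : 0 < a₂ := lt_of_lt_of_le ha₁ h12
  have hγ₁ := (gammaPs_pos (d := d + 1) (a' := a₁)).1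
  have hσ₂ := sigma0_pos (d := d + 1) ha₂
  -- one admissible rate for the whole interval
  obtain ⟨hcont, hzero⟩ := continuousAt_deltaKu (D := d + 1) (a₁ := a₁) (a₂ := a₂)
  have ev1 : ∀ᶠ κ : ℝ in 𝓝 0, Jfree (d + 1) a₂ κ 1 < gammaPs (d + 1) a₁ := by
    have hc := (continuous_Jfree (d + 1) a₂ 1).continuousAt (x := (0 : ℝ))
    have : Jfree (d + 1) a₂ 0 1 < gammaPs (d + 1) a₁ := by rw [Jfree_zero]; exact hγ₁
    exact hc.eventually_lt continuousAt_const this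
  have ev2 : ∀ᶠ κ : ℝ in 𝓝 0, deltaKu (d + 1) a₁ a₂ κ < sigma0 (d + 1) a₂ ^ 2 / 2 := by
    have : deltaKu (d + 1) a₁ a₂ 0 < sigma0 (d + 1) a₂ ^ 2 / 2 := by rw [hzero]; positivity
    exact hcont.eventually_lt continuousAt_const this
  obtain ⟨κ, hκ0, -, hJ2, hδ2⟩ := exists_pos_le_one_of_eventually (ev1.and ev2)
  have hgapU : 0 < gwU (d + 1) a₁ a₂ κ := by unfold gwU; linarith
  refine ⟨(sigma0 (d + 1) a₂ ^ 2 / 2)⁻¹ * Real.exp κ, κ, by positivity, hκ0, ?_⟩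
  intro a' h1 h2 M _ n _ k ι _ _
  have ha' : 0 < a' := lt_of_lt_of_le ha₁ h1
  have hnpos : (0 : ℝ) < (n : ℝ) ^ (d + 1) := pow_pos (Nat.cast_pos.mpr (Nat.pos_of_ne_zero (NeZero.ne n))) _
  -- the per-`a′` hypotheses of n15-c∕222, from the monotone majorants
  have hJ : Jfree (d + 1) a' κ 1 < gammaPs (d + 1) a' :=
    lt_of_le_of_lt (Jfree_mono_a (d + 1) h2 κ 1) (lt_of_lt_of_le hJ2 (gammaPs_mono (d + 1) ha₁ h1))
  have hσm : sigma0 (d + 1) a₂ ≤ sigma0 (d + 1) a' := sigma0_anti (d + 1) ha' h2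
  have hσsq : sigma0 (d + 1) a₂ ^ 2 ≤ sigma0 (d + 1) a' ^ 2 := pow_le_pow_left₀ hσ₂.le hσm 2
  have hδK : BalabanUV.T4Continuum.CTGaugeTerm.deltaK (d + 1) a' κ 1 ≤ deltaKu (d + 1) a₁ a₂ κ := deltaK_le_deltaKu ha₁ h1 h2 hgapU
  have hδ : BalabanUV.T4Continuum.CTGaugeTerm.deltaK (d + 1) a' κ 1 < sigma0 (d + 1) a' ^ 2 := by nlinarith [sq_nonneg (sigma0 (d + 1) a₂)]
  have hgap : sigma0 (d + 1) a₂ ^ 2 / 2 ≤ sigma0 (d + 1) a' ^ 2 - BalabanUV.T4Continuum.CTGaugeTerm.deltaK (d + 1) a' κ 1 := by linarith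
  have hC : (sigma0 (d + 1) a' ^ 2 - BalabanUV.T4Continuum.CTGaugeTerm.deltaK (d + 1) a' κ 1)⁻¹ ≤ (sigma0 (d + 1) a₂ ^ 2 / 2)⁻¹ := inv_anti₀ (by positivity) hgap
  -- `cSop(1)⁻¹ = Re Kone⁻¹ ⊗ 1` (as in n15-c∕222)
  have hK := (isReal_Kone M n a').2.2
  have hKinv : Kone n M a' * (Kone n M a')⁻¹ = 1 := Matrix.mul_nonsing_inv _ (isUnit_det_Kone n M ha')
  have hdetR : IsUnit (reM (Kone n M a')).det :=
    Matrix.isUnit_det_of_right_inverse (B := reM ((Kone n M a')⁻¹)) (by rw [← hK.reM_mul hK.inv, hKinv, B5RealFields.reM_one])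
  have hinv : (cSop M n (fun (_ : Fin (d + 1)) (_ : Tor (fine n M)) => (1 : Matrix ι ι ℝ)) (a' * (n : ℝ) ^ (d + 1)))⁻¹ = reM ((Kone n M a')⁻¹) ⊗ₖ (1 : Matrix ι ι ℝ) := by
    rw [cSop_one, sopFlat_eq_reM M n ha', ← hK.reM_inv hKinv]
    refine Matrix.inv_eq_left_inv ?_
    rw [← Matrix.mul_kronecker_mul, Matrix.nonsing_inv_mul _ hdetR, Matrix.one_mul, Matrix.one_kronecker_one]
  rw [hinv]
  refine hasMaj_mulVecLin_of_sum_abs_le (g := unitTorusGeo L k M) (liftBlk (fun y : Tor M => y) ι) (liftBlk (fun y : Tor M => y) ι) (fun y y' => by positivity) fun p w => ?_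
  rw [sum_fibre_blkC]
  have hent : ∀ j : ι, |(reM ((Kone n M a')⁻¹) ⊗ₖ (1 : Matrix ι ι ℝ)) p (w, j)| = |((Kone n M a')⁻¹ p.1 w).re| * (if p.2 = j then 1 else 0) := by
    intro j
    rw [Matrix.kroneckerMap_apply, reM_apply, Matrix.one_apply, abs_mul]
    split_ifs <;> simp
  simp_rw [hent]
  rw [← Finset.mul_sum, Finset.sum_ite_eq Finset.univ p.2, if_pos (Finset.mem_univ _), mul_one]
  refine (Complex.abs_re_le_norm _).trans ((norm_Kone_inv_apply_le M n ha' hκ0.le hJ hδ p.1 w).trans ?_)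
  rw [show liftBlk (fun y : Tor M => y) ι p = p.1 from rfl]
  have hE0 := Real.exp_nonneg (-(κ * tdistT M p.1 w))
  have hexp := Real.exp_pos κ
  calc (n : ℝ) ^ (d + 1) * (sigma0 (d + 1) a' ^ 2 - BalabanUV.T4Continuum.CTGaugeTerm.deltaK (d + 1) a' κ 1)⁻¹ * Real.exp κ * Real.exp (-(κ * tdistT M p.1 w))
      ≤ (n : ℝ) ^ (d + 1) * (sigma0 (d + 1) a₂ ^ 2 / 2)⁻¹ * Real.exp κ * Real.exp (-(κ * tdistT M p.1 w)) := by gcongr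
    _ = (sigma0 (d + 1) a₂ ^ 2 / 2)⁻¹ * Real.exp κ * (n : ℝ) ^ (d + 1) * Real.exp (-(κ * tdistT M p.1 w)) := by ring

end Row

end Summit.QuantumFields.YangMills.BalabanUVNodes.N15.CovLandau

end
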